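import Summits.BirchSwinnertonDyer.Rank1Residual.X11b.LevelLiftingFromFiniteness
import Summits.BirchSwinnertonDyer.Rank1Residual.X11b.RelaxedSelmerFinite
import Summits.BirchSwinnertonDyer.Rank1Residual.X11b.LocalPrimaryFinite
import Summits.BirchSwinnertonDyer.Rank1Residual.X11b.AnticyclotomicControlLocallyTrivialClass
import Summits.BirchSwinnertonDyer.Rank1Residual.X11b.AnticyclotomicLocalTorsionDescent
import Summits.BirchSwinnertonDyer.Rank1Residual.X11b.BDPRouteLocalIndexTransport
import Summits.BirchSwinnertonDyer.Rank1Residual.X11b.RouteR1ControlAtoms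
import Summits.BirchSwinnertonDyer.Rank1Residual.X11b.AnticyclotomicControlSplitImprimitive
import HarnessLib

/-!
# X11b, route R1 — atom (P9) ELIMINATED from the statement of record: on route R1's data,
# (P9) follows from (P6) at the conjugate prime, Poitou–Tate duality and Milne I 2.8

HONEST FRAMING (cell `b2b-bsdres`, run/shared/lean/b2b/bsd-rank1-residual/, verbatim in every
file): the goal of the cell is to DELETE the COMBINATION-SHAPED residual classes of the
Birch–Swinnerton-Dyer formula for ALL analytic-rank `≤ 1` elliptic curves over `ℚ` — "full BSD
formula for every rank `≤ 1` curve in class `C`" assembled STRICTLY from published theorems — so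
that the rank-`≤ 1` remainder becomes exactly the CONSTRUCTION-SHAPED classes, which are TYPED
(missing-input `Prop`s), NOT attempted. This is not "finishing BSD". Sub-cell
`b2b-bsdres-multr1-p1` (X11b, route R1 = Castella 2018 Thm. A re-proved along the author's
erratum); a RESEARCH ROUTE; no claim beyond the stated class; X11b stays CONSTRUCTION-SHAPED;
nothing here changes a label; no named fact is minted (theorems only; no `sorry`).  CONDITIONAL on
two CITED named facts taken as hypotheses: `poitouTate_selmerStructure_duality` (Howard 2004
Thm. 2.1.11 / Milne I 4.10(b)) and `localEulerPoincareCharacteristic` (Milne I Thm. 2.8).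

## What is here

On the data of route R1 (`R1PoitouTateAtomsAt`: an erratum field `K` — imaginary quadratic, every
`ℓ ∣ N_E`, `ℓ ≠ q` split, in particular `p = 𝔭𝔭̄` —, the A′-hypotheses, a degree-one `𝔭 ∋ p`), the
Poitou–Tate atom (P9) `LocSurjAt (W_K) p 𝔭 Σ(N⁺)` (JSW17 Prop. 3.3.2) is DERIVED
(`locSurjAt_of_baseSelmerCount_conj`) from:
* (P6) `BaseSelmerCountAt` at the CONJUGATE prime `𝔭̄` (its finiteness clause
  `Finite (Sel_𝔭̄(K, E[p^∞]))` — the same typed atom the statement of record already consumes at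
  every degree-one prime above `p`);
* the two cited facts; and tree theorems: `levelLiftingAt_of_finite` (`LevelLiftingFromFiniteness`),
  `finite_selmerGroup_acStructure_of_finite_empty` (`RelaxedSelmerFinite`),
  `finite_galoisCohomology_one_primary_toLocal` (`LocalPrimaryFinite`), the conjugate prime
  (`exists_conj_prime_of_splitsIn`, `degreeOne_of_splitsIn`), `E(K̄)[p^∞]^{Γ_K} = 0` from (irr)/(iv)
  (`ErratumHypotheses.fixedPoints_decomp_inf_kerSubgroup_eq_bot`), and the finite exceptional set
  `T = ∞ ∪ {v : ℓ(v) ∣ p·N_E}` (bad places of `E/K` lie over `ℓ ∣ N_E`: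
  `hasGoodReductionAt_of_not_dvd_conductorNorm` + `hasGoodReductionAt_baseChange_of_hasGoodReductionAt_rat`).

Consequences: `r1PoitouTateAtomsAt_of_twoAtoms` (the three-atom shape from the TWO-atom shape
(P6) ∧ (L10)), and the statement of record **`R1.bsdp_of_onTree_twoAtoms_facts`**: BSD_p on
`R1Population` with `r_an = 1` from the nine published facts of `R1.bsdp`, the two cited duality
facts, the TWO Poitou–Tate shapes (P6), (L10) at every datum, the local shape (P11) off the
locally-trivial sub-population, and the ONE OPEN input `R1OpenInputOnTreeAt`.  CONDITIONAL;
deletes nothing; X11b stays CONSTRUCTION-SHAPED; no label change.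

References: [JetchevSkinnerWan2017] Prop. 3.3.2 (arXiv:1512.06894 p. 11); [Castella2018] Thm. 2.3,
§5; [Castella2018Erratum] Thm. 1.1, Thm. A′; [Howard2004HeegnerKolyvagin] Thm. 2.1.11;
[MilneADT2006] I Thm. 2.8, Thm. 4.10.
-/

noncomputable section

open scoped Classical

open WeierstrassCurve NumberField IsDedekindDomain Field
open Literature.NumberTheory.EllipticCurves Literature.NumberTheory.EllipticCurves.GreenbergSelmer
open Literature.NumberTheory.EllipticCurves.ModularForms
open Literature.NumberTheory.EllipticCurves.Rank1Residual
open Literature.NumberTheory.EllipticCurves.Rank1Residual.Typed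
open Literature.NumberTheory.GaloisRepresentations
open Literature.NumberTheory.GaloisCohomology
open Summit.BirchSwinnertonDyer.Rank1Residual.X11b.AcSelmer
open Summit.BirchSwinnertonDyer.Rank1Residual.X11b.LocBridge

namespace Summit.BirchSwinnertonDyer.Rank1Residual.X11b

/-! ## §1. The finite exceptional set of places `T = ∞ ∪ {v : ℓ(v) ∣ p · N_E}` -/

section ExceptionalSet

variable (W : WeierstrassCurve ℚ) [W.IsElliptic] (K : Type) [Field K] [NumberField K] (p : ℕ)
  [Fact p.Prime]

/-- **The exceptional set** `T(E, K, p)`: all infinite places and the finite places over the primes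
dividing `p · N_E` (finite for `[K:ℚ] = 2`, `finite_setOf_primesEquiv_under_dvd`). [folklore] -/
def exceptionalPlaces (hK : Module.finrank ℚ K = 2) : Finset (Place K) :=
  (Finset.univ.image Sum.inl) ∪
    ((finite_setOf_primesEquiv_under_dvd K hK
      (mul_ne_zero (Fact.out : p.Prime).ne_zero (WeierstrassCurve.conductorNorm_pos_holds W).ne')).toFinset.image
      Sum.inr)

variable {W K p}

/-- Membership of a finite place in `T`. [folklore] -/
theorem inr_mem_exceptionalPlaces_iff (hK : Module.finrank ℚ K = 2) (v : HeightOneSpectrum (𝓞 K)) :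
    (Sum.inr v : Place K) ∈ exceptionalPlaces W K p hK ↔
      (Rat.HeightOneSpectrum.primesEquiv (v.under (𝓞 ℚ)) : ℕ) ∣ p * W.conductorNorm ℤ := by
  simp only [exceptionalPlaces, Finset.mem_union, Finset.mem_image, Finset.mem_univ, true_and,
    reduceCtorEq, exists_false, false_or, Set.Finite.mem_toFinset, Set.mem_setOf_eq, Sum.inr.injEq,
    exists_eq_right]

/-- Every infinite place is in `T`. [folklore] -/
theorem inl_mem_exceptionalPlaces (hK : Module.finrank ℚ K = 2) (w : InfinitePlace K) :
    (Sum.inl w : Place K) ∈ exceptionalPlaces W K p hK :=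
  Finset.mem_union_left _ (Finset.mem_image_of_mem _ (Finset.mem_univ w))

/-- Every place above `p` is in `T`. [folklore] -/
theorem inr_mem_exceptionalPlaces_of_mem (hK : Module.finrank ℚ K = 2) {v : HeightOneSpectrum (𝓞 K)}
    (hv : ((p : ℕ) : 𝓞 K) ∈ v.asIdeal) : (Sum.inr v : Place K) ∈ exceptionalPlaces W K p hK := by
  rw [inr_mem_exceptionalPlaces_iff, under_eq_ratPlace_of_mem hv, primesEquiv_ratPlace]
  exact dvd_mul_right p _

/-- Every place of `Σ(N⁺)` is in `T`. [folklore] -/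
theorem inr_mem_exceptionalPlaces_of_mem_nPlusPlaces (hK : Module.finrank ℚ K = 2)
    {v : HeightOneSpectrum (𝓞 K)} (hv : v ∈ nPlusPlaces W K p) :
    (Sum.inr v : Place K) ∈ exceptionalPlaces W K p hK := by
  rw [inr_mem_exceptionalPlaces_iff]
  exact dvd_mul_of_dvd_right hv.2.1 p

/-- Every bad place of `E/K` is in `T`. [folklore] -/
theorem inr_mem_exceptionalPlaces_of_not_hasGoodReductionAt (hK : Module.finrank ℚ K = 2) {v : HeightOneSpectrum (𝓞 K)}
    (hv : ¬ (W.baseChange K).HasGoodReductionAt v) :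
    (Sum.inr v : Place K) ∈ exceptionalPlaces W K p hK := by
  rw [inr_mem_exceptionalPlaces_iff]
  exact dvd_mul_of_dvd_right (primesEquiv_under_dvd_conductorNorm_of_not_hasGoodReductionAt K v hv) p

/-- The relaxation set `R = {v ∈ T : v ∤ p}` is finite. [folklore] -/
theorem finite_relaxationSet (hK : Module.finrank ℚ K = 2) :
    {v : HeightOneSpectrum (𝓞 K) | (Sum.inr v : Place K) ∈ exceptionalPlaces W K p hK ∧
      ((p : ℕ) : 𝓞 K) ∉ v.asIdeal}.Finite :=
  (finite_setOf_primesEquiv_under_dvd K hK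
    (mul_ne_zero (Fact.out : p.Prime).ne_zero (WeierstrassCurve.conductorNorm_pos_holds W).ne')).subset
    fun v hv ↦ (inr_mem_exceptionalPlaces_iff hK v).mp hv.1

end ExceptionalSet

/-! ## §2. (P9) at a datum of route R1 from (P6) at the conjugate prime -/

section Atom

variable (W : WeierstrassCurve ℚ) [W.IsElliptic] [W.IsGloballyMinimal] (p : ℕ) [Fact p.Prime]

/-- `E(K̄)[p^∞]^{Γ_K} = 0` on route R1's data (from the A′-hypotheses: (iv) gives even
`E(K̄)[p^∞]^{D_𝔭 ∩ ker κ} = 0`, `ErratumHypotheses.fixedPoints_decomp_inf_kerSubgroup_eq_bot`).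
[cite: Castella2018Erratum, Thm. 1.1 (iv), Lemma 2.1 (pp. 1–2)] -/
theorem ErratumHypotheses.noInvariants (hE : ErratumHypotheses W p) (K : Type) [Field K]
    [NumberField K] (κ : ZpExtension K p) (𝔭 : HeightOneSpectrum (𝓞 K))
    (h𝔭 : ((p : ℕ) : 𝓞 K) ∈ 𝔭.asIdeal) (he : 𝔭.asIdeal.ramificationIdx (𝓞 ℚ) = 1)
    (hf : 𝔭.asIdeal.inertiaDeg (𝓞 ℚ) = 1) (Q : (W.baseChange K).geomPrimaryTorsion p)
    (hQ : ∀ σ : absoluteGaloisGroup K, primaryGaloisModule (W.baseChange K) p σ Q = Q) : Q = 0 := by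
  have h := hE.fixedPoints_decomp_inf_kerSubgroup_eq_bot K κ 𝔭 h𝔭 he hf
  have hmem : Q ∈ FixedPoints.addSubgroup ↥(decomp 𝔭 ⊓ κ.kerSubgroup)
      ((W.baseChange K).geomPrimaryTorsion p) :=
    (FixedPoints.mem_addSubgroup _ _ Q).mpr fun d ↦ hQ (d : absoluteGaloisGroup K)
  rw [h] at hmem
  exact (AddSubgroup.mem_bot).mp hmem

/-- **(P9) at a datum of route R1, from (P6)'s finiteness clause at the conjugate prime.**  For an
erratum field `K` (imaginary quadratic), the A′-hypotheses, a degree-one `𝔭 ∋ p` and another prime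
`𝔮 ∋ p`: if `Sel_𝔮(K, E[p^∞])` is finite (e.g. from `BaseSelmerCountAt p 𝔮 …`), then
`LocSurjAt (W_K) p 𝔭 Σ(N⁺)` — GIVEN the cited Poitou–Tate duality for `K` and Milne I 2.8 at the
completions of `K`. [cite: JetchevSkinnerWan2017, Prop. 3.3.2 (arXiv:1512.06894 p. 11)]
[cite: Castella2018, Thm. 2.3 (arXiv:1704.06608 p. 5)] -/
theorem locSurjAt_of_finite_conj (hE : ErratumHypotheses W p) {q : ℕ} {K : Type} [Field K]
    [NumberField K] (hPT : poitouTate_selmerStructure_duality K)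
    (hEP : ∀ v : HeightOneSpectrum (𝓞 K), localEulerPoincareCharacteristic (v.adicCompletion K))
    (hK : IsErratumField W K q) (κ : ZpExtension K p) {𝔭 𝔮 : HeightOneSpectrum (𝓞 K)}
    (h𝔭 : ((p : ℕ) : 𝓞 K) ∈ 𝔭.asIdeal) (he : 𝔭.asIdeal.ramificationIdx (𝓞 ℚ) = 1)
    (hf : 𝔭.asIdeal.inertiaDeg (𝓞 ℚ) = 1) (h𝔮 : ((p : ℕ) : 𝓞 K) ∈ 𝔮.asIdeal) (hne : 𝔮 ≠ 𝔭)
    (hfin : Finite (selmerAcBase (W.baseChange K) p 𝔮 ∅)) :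
    LocSurjAt (W.baseChange K) p 𝔭 (nPlusPlaces_finite (W := W) (p := p) hK.1.1) := by
  haveI : IsTotallyComplex K := hK.1.2
  haveI := hfin
  -- finiteness of Castella's conjugate group, unrelaxed and relaxed on `R = {v ∈ T : v ∤ p}`
  have hfin0 : Finite (acStructure (primaryGaloisModule (W.baseChange K) p) p 𝔮
      (∅ : Set (HeightOneSpectrum (𝓞 K)))).selmerGroup := by
    refine Nat.finite_of_card_ne_zero ?_
    rw [← natCard_selmerAcBase_eq_natCard_selmerGroup (W.baseChange K) p 𝔮 ∅]
    exact Nat.card_pos.ne'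
  have hfinR : Finite (acStructure (primaryGaloisModule (W.baseChange K) p) p 𝔮
      {v | (Sum.inr v : Place K) ∈ exceptionalPlaces W K p hK.1.1 ∧
        ((p : ℕ) : 𝓞 K) ∉ v.asIdeal}).selmerGroup :=
    finite_selmerGroup_acStructure_of_finite_empty _ p 𝔮 _ (finite_relaxationSet hK.1.1) hfin0
      fun v hv _ ↦ finite_galoisCohomology_one_primary_toLocal (W.baseChange K) p v (hEP v) hv.2
  exact locSurjAt_of_finite (W.baseChange K) p 𝔭 (exceptionalPlaces W K p hK.1.1) hPT
    (fun w ↦ IsTotallyComplex.isComplex w)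
    (fun Q hQ ↦ ErratumHypotheses.noInvariants W p hE K κ 𝔭 h𝔭 he hf Q hQ) h𝔭 h𝔮 hne
    (nPlusPlaces_finite (W := W) (p := p) hK.1.1) (fun v hv ↦ hv.1)
    (inl_mem_exceptionalPlaces hK.1.1) (fun v hv ↦ inr_mem_exceptionalPlaces_of_mem hK.1.1 hv)
    (fun v hv ↦ inr_mem_exceptionalPlaces_of_mem_nPlusPlaces hK.1.1 hv)
    (fun v hv ↦ inr_mem_exceptionalPlaces_of_not_hasGoodReductionAt hK.1.1 hv) hfinR

/-- **The three Poitou–Tate atoms of route R1 from the TWO atoms (P6) ∧ (L10)** and the two cited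
duality facts: at every datum, (P9) `LocSurjAt` follows from (P6) at the conjugate degree-one prime
`𝔭̄` (`exists_conj_prime_of_splitsIn`, `degreeOne_of_splitsIn`; its finiteness clause) by
`locSurjAt_of_finite_conj`. [cite: JetchevSkinnerWan2017, Prop. 3.2.1, Prop. 3.3.2, Lemma 3.3.3 (arXiv:1512.06894 pp. 10–12)]
[cite: Castella2018, Thm. 2.3 (arXiv:1704.06608 p. 5)] -/
theorem r1PoitouTateAtomsAt_of_twoAtoms
    (hPT : ∀ (K : Type) [Field K] [NumberField K], poitouTate_selmerStructure_duality K)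
    (hEP : ∀ (K : Type) [Field K] [NumberField K] (v : HeightOneSpectrum (𝓞 K)),
      localEulerPoincareCharacteristic (v.adicCompletion K))
    (h2 : R1TwoAtomsAt W p) : R1PoitouTateAtomsAt W p := by
  intro _ q _ K _ _ Dt H ι P hE hr hqp hmq hns hvq hK hCas hP hc hinf κ hκ γ _ 𝔭 h𝔭 he hf
  obtain ⟨h6, h10⟩ := h2 q K Dt H ι P hE hr hqp hmq hns hvq hK hCas hP hc hinf κ hκ γ 𝔭 h𝔭 he hf
  have hpN : p ∣ W.conductorNorm ℤ := dvd_conductorNorm_of_mult hE.2.1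
  have hsplit : SplitsIn K p := hK.2.2.1 p (Fact.out : p.Prime) hpN (Ne.symm hqp)
  obtain ⟨σ, 𝔮, -, hne, h𝔮, -⟩ :=
    LocalIndexTransport.exists_conj_prime_of_splitsIn K p hK.1.1 hsplit h𝔭
  obtain ⟨he', hf'⟩ := degreeOne_of_splitsIn hK.1.1 hsplit h𝔮
  obtain ⟨h6', -⟩ := h2 q K Dt H ι P hE hr hqp hmq hns hvq hK hCas hP hc hinf κ hκ γ 𝔮 h𝔮 he' hf'
  obtain ⟨a, ⟨hfinq, -⟩, -⟩ := h6'
  exact ⟨h6, locSurjAt_of_finite_conj W p hE (hPT K) (hEP K) hK κ h𝔭 he hf h𝔮 hne hfinq, h10⟩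

end Atom

/-! ## §3. Statement of record: two Poitou–Tate atoms everywhere, (P11) off the locally-trivial pairs -/

section Record

variable (W : WeierstrassCurve ℚ) [W.IsElliptic] [W.IsGloballyMinimal] (p : ℕ) [Fact p.Prime]

/-- **Route R1 — statement of record, (P9) eliminated.**  For every globally minimal elliptic `W/ℚ` and
prime `p` on `R1Population` with `ord_{s=1} L(E,s) = 1`: `BSD(E,p)`, from the NINE PUBLISHED named
facts of `R1.bsdp` (Gross–Zagier 1986 I.7.3, GZK, Skinner 2016 Thm. C, modularity, Cai–Shu–Tian
2014 Thm. 1.1, Friedberg–Hoffstein 1995 Thm. B, Mazur 1978 Cor. 4.1, Néron mapping property), the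
two CITED duality facts (Poitou–Tate duality for Selmer structures, Howard Thm. 2.1.11 / Milne I
4.10(b); local Euler–Poincaré characteristic, Milne I 2.8), the TWO typed Poitou–Tate shapes (P6)
JSW17 Prop. 3.2.1/(7.1.5) and (L10) Lemma 3.3.3 at every datum, the local shape (P11) Prop. 3.3.4
Case 1(a) on the pairs off the locally-trivial sub-population, and the ONE OPEN input
`R1OpenInputOnTreeAt` ((IMC)∘(BDP) at `𝟙`: erratum Thm. 1.1 ⇐ [FW21, Thm. 4.41], PREPRINT).  Atom
(P9) JSW17 Prop. 3.3.2 is now a tree theorem (`r1PoitouTateAtomsAt_of_twoAtoms`). CONDITIONAL;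
deletes nothing; X11b stays CONSTRUCTION-SHAPED; no label change.
[cite: Castella2018, §5 (arXiv:1704.06608 p. 12)] [cite: Castella2018Erratum, Thm. 1.1, Thm. A′ (p. 1)]
[cite: JetchevSkinnerWan2017, Thm. 3.3.1, Prop. 3.3.2 (arXiv:1512.06894 p. 11)] -/
theorem R1.bsdp_of_onTree_twoAtoms_facts
    (hGZ : GrossZagier1986_thm_I_7_3) (hGZK : rank_eq_analyticRank_of_analyticRank_le_one)
    (hSk : Skinner2016.thmC_padicValRat_bsd_rank_zero) (hmod : exists_isNewformOf)
    (hCST : CaiShuTian2014.thm11_trivialChar)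
    (hFH : friedbergHoffstein_exists_twist_ne_zero_ramifiedAt)
    (hMaz : mazur_not_dvd_maninConstant_of_odd) (hNS : integral_neronScaling_of_isGloballyMinimal)
    (hPT : ∀ (K : Type) [Field K] [NumberField K], poitouTate_selmerStructure_duality K)
    (hEP : ∀ (K : Type) [Field K] [NumberField K] (v : HeightOneSpectrum (𝓞 K)),
      localEulerPoincareCharacteristic (v.adicCompletion K))
    (h2 : ∀ (W : WeierstrassCurve ℚ) [W.IsElliptic] [W.IsGloballyMinimal] (p : ℕ) [Fact p.Prime],
      R1TwoAtomsAt W p)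
    (h11 : ∀ (W : WeierstrassCurve ℚ) [W.IsElliptic] [W.IsGloballyMinimal] (p : ℕ) [Fact p.Prime],
      ¬ LocallyTrivialAt W p → R1LocalKernelOrderAt W p)
    (hA : ∀ (W : WeierstrassCurve ℚ) [W.IsElliptic] [W.IsGloballyMinimal] (p : ℕ) [Fact p.Prime],
      R1OpenInputOnTreeAt W p)
    (hW : R1Population W p) (hr : W.analyticRank = 1) : BSDp W p :=
  R1.bsdp_of_onTree_split_atoms W p hGZ hGZK hSk hmod hCST hFH hMaz hNS (fun W _ _ p _ _ ↦ h2 W p)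
    (fun W _ _ p _ hLT ↦ ⟨r1PoitouTateAtomsAt_of_twoAtoms W p hPT hEP (h2 W p), h11 W p hLT⟩) hA hW hr

end Record


end Summit.BirchSwinnertonDyer.Rank1Residual.X11b

end
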